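import Summits.QuantumFields.YangMills.Theorems.UnitScaleTiltProp7HPcolNegConstantMode
import Summits.QuantumFields.YangMills.Theorems.UnitScaleTiltProp7HPcolNegCommutatorLattice
import Summits.QuantumFields.YangMills.Theorems.UnitScaleTiltProp7HPcolNegRegPr
import HarnessLib

/-!
# NEG-hPcol piece (N4): **THE DELOCALISED LOW MODE IN `N_S(U_s)` IS THE CONSTANT** — SPEC-0 `spec_lowMode` for px12 g11's explicit stratum-(c) family,
# with `lam := fun _ => c`, `C₁ = 0`, `C₂ = 2`

Cell `ym3-torus` (YM ladder rung R3 = continuum SU(2) Yang–Mills on T³ — a RUNG, NOT d = 4, NOT infinite volume, NOT a mass gap, NOT the Clay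
problem), width seat `ym3-torus-px13` (gen 10), crux of record `MinimiserStabilityRegPr` (stmt-QuantumFields-19200, route `UnitScaleTilt`).
★★OWNER WORD 38 (2026-08-29T18:26Z) «NEG-hPcol — GO»: a kernel certificate that the S42ᴸ display row `hPcol` (pre-`Lift` text, ✓p729698) is NOT
inhabitable on px12 g11's explicit stratum-(c) family (LOCATE v2.1 8aced68d) `U_s(b) := expHerm ((s·θ((b₋)_{dir b} mod L)) • σ_{dir b})`,
`θ = (1, −1, 0, …)`; px12 g11's NAMING LINE (18:30:32Z ∕ 18:41:38Z) cut it into pieces N1–N6; «px13 g10: N4 GO» (19:11:40Z).  THIS FILE is piece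
**(N4)** = SPEC-0 e654b2a4 `spec_lowMode` TOKEN FOR TOKEN, as the MEMBER INSTANCE of ✓`Prop7HPcolNegConstantMode.lowMode_const` (px13 g10, the
generic core «the low mode is the constant»): `hper` from the one-block periodicity of `U_s` (§1), `htriv` = px12 g11's N3b
✓`Prop7HPcolNegCommutatorLattice.spec_emlIterU_field_eq_one` (`Ū_sʲ ≡ 1`, `1 ≤ j`, `s ≤ 1∕(40L)`), `hreg` = N3c ✓`Prop7HPcolNegRegPr.spec_regPr_field`
at `ρ = (10¹²L³)⁻¹`, and the bond window `‖U_s(b) − 1‖ ≤ s` (§2, px6 g11's (N2a) ✓`norm_exp_I_smul_pauli_sub_one_le`).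

WHAT IS PROVED (def-free; ns `…Theorems.Prop7HPcolNegLowMode`):
* §1 `val_add_scale_mod` (residues mod `L` are invariant under the fine translation by a coarse vector `L·a`; px12's ✓`L_dvd_sitesPerDir_zero`),
  ★ `bgUnits_field_translate_scale` (`τ_{L·a} U_s♭ = U_s♭` — ONE-BLOCK PERIODICITY, LOCATE v2.1 (a), in the `translate`∕`Site.scale` letters),
  ★ `holT_emb_field_eq` (centre-based transports of `U_s♭` do not depend on the block: ✓`Prop7HPcolNegConstantMode.holT_emb_eq_of_blockPeriodic`).
* §2 ★ `norm_field_sub_one_le` (`‖U_s(b) − 1‖ ≤ s`).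
* §3 ★★★ `spec_lowMode` — SPEC-0 N4 token for token (the unused binder `hc : c.trace = 0` is kept, spelled `_hc`): `C₁ = 0`, `C₂ = 2`,
  `s₂ = min s₁ (1∕(40L))`, `lam := fun _ => c`.

HONEST FRAMING.  Bookkeeping over landed letters; `hPcol` is a display BINDER — NEG-hPcol is negative knowledge of record for TARGET.md footnote 17v,
NOT an item refutation, NOT a display event, NOT progress on EX; nothing of EX ∕ the 13 print rows ∕ `hThm2S` ∕ 19200 ∕ any crux or rung statement
is proved here; the Yang–Mills mass gap is NOT proved.

References: T. Bałaban, CMP **99** (1985) 389–434 [Balaban1985BackgroundPropagators] ((3.3) p.391, (3.19)–(3.21) pp.393–394); CMP **109** (1987)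
249–301 [Balaban1987RG1] ((0.1) p.251); CMP **98** (1985) 17–51 [Balaban1985Averaging] ((9) p.18, (19) p.21); CMP **102** (1985) 277–309
[Balaban1985Variational] ((2) p.278, (112) p.294).
-/

set_option autoImplicit false

noncomputable section

open scoped BigOperators Matrix.Norms.L2Operator

namespace Summit.QuantumFields.YangMills.Theorems.Prop7HPcolNegLowMode

open NormedSpace
open Literature.MathematicalPhysics.QuantumFieldTheory.Balaban1983to89
open Literature.MathematicalPhysics.QuantumFieldTheory.Balaban1983to89.T3ContinuumYM3Torus
open Literature.MathematicalPhysics.QuantumLattice (spinHalfPauli)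
open T4Continuum BlockAveraging
open B10Eq27TorusAxialLog (holT)
open Summit.QuantumFields.YangMills.Theorems.Prop8Chart (emlIterU)
open T3PrintedRegularMinimiser (RegPr)
open T3SectALandauChart (bgUnits)
open Summit.QuantumFields.YangMills.Theorems.Prop7SectET3HilbertLetters (toL2 toL2S DL2)
open Summit.QuantumFields.YangMills.Theorems.Prop7SectET3GaugeProjector (NS)
open Summit.QuantumFields.YangMills.Theorems.Prop7TPrint (expHerm expHermField expHermField_apply)
open Summit.QuantumFields.YangMills.Theorems.Prop7HPcolNegPauliExp (coe_expHerm_smul_pauli norm_exp_I_smul_pauli_sub_one_le)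
open Summit.QuantumFields.YangMills.Theorems.Prop7HPcolNegConstantMode (holT_emb_eq_of_blockPeriodic lowMode_const)

variable (F : T3Family) (K : ℕ)

/-! ## §1 The commutator lattice is one-block periodic -/

/-- The residue of a coordinate modulo the block side `L` is invariant under the fine translation by a coarse vector `L·a`.
[cite: Balaban1987RG1, (0.1) p.251] -/
theorem val_add_scale_mod (x : Site (F.P K) 0) (a : Site (F.P K) 1) (μ : Fin (F.P K).d) :
    ((x + Site.scale a) μ).val % F.L = (x μ).val % F.L := by
  have hd : F.L ∣ (F.P K).sitesPerDir 0 := Prop7HPcolNegCommutatorLattice.L_dvd_sitesPerDir_zero F K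
  rw [Site.add_apply, Site.scale_apply, Site.scaleCoord_apply, ZMod.val_add, Nat.mod_mod_of_dvd _ hd, ZMod.val_natCast,
    Nat.add_mod, Nat.mod_mod_of_dvd _ hd, show (F.P K).L = F.L from rfl, Nat.mul_mod_left, add_zero, Nat.mod_mod]

/-- ★ **ONE-BLOCK PERIODICITY OF THE COMMUTATOR LATTICE** (px12 g11 LOCATE v2.1 (a)): `τ_{L·a} U_s = U_s` for every coarse vector `a` — the bond
value depends only on the direction and on the residue of the `dir`-coordinate modulo `L`; read in the units of `M₂(ℂ)`.
[cite: Balaban1987RG1, (0.1) p.251; Balaban1985Variational, (112) p.294] -/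
theorem bgUnits_field_translate_scale (s : ℝ) (a : Site (F.P K) 1) :
    (bgUnits F K (expHermField (F := F) (K := K)
      (fun b : PBond (F.P K) 0 =>
        (((s * (if (b.src b.dir).val % F.L = 0 then (1 : ℝ) else if (b.src b.dir).val % F.L = 1 then -1 else 0)) : ℝ) : ℂ) •
          spinHalfPauli b.dir))).translate (Site.scale a) =
    bgUnits F K (expHermField (F := F) (K := K)
      (fun b : PBond (F.P K) 0 =>
        (((s * (if (b.src b.dir).val % F.L = 0 then (1 : ℝ) else if (b.src b.dir).val % F.L = 1 then -1 else 0)) : ℝ) : ℂ) •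
          spinHalfPauli b.dir)) := by
  funext b
  rw [GaugeField.translate_apply]
  show T3SectALandauChart.bgUnits F K _ ⟨b.src + Site.scale a, b.dir⟩ = _
  unfold T3SectALandauChart.bgUnits B10Eq27TorusAxialLog.unitsField B10Eq27TorusAxialLog.toUField
  simp only [expHermField_apply, val_add_scale_mod]

/-- ★ Hence the level-0 transports of `U_s♭` read from block centres do not depend on the block (the `hper` row of
✓`Prop7HPcolNegConstantMode.toL2S_const_mem_NS`). [cite: Balaban1987RG1, (0.1) p.251; Balaban1985Averaging, (9) p.18] -/
theorem holT_emb_field_eq (s : ℝ) (y y₀ : Site (F.P K) 1) (w : List (B7Prop1Explicit.Letter (F.P K).d)) :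
    holT (bgUnits F K (expHermField (F := F) (K := K)
      (fun b : PBond (F.P K) 0 =>
        (((s * (if (b.src b.dir).val % F.L = 0 then (1 : ℝ) else if (b.src b.dir).val % F.L = 1 then -1 else 0)) : ℝ) : ℂ) •
          spinHalfPauli b.dir))) (emb y) w =
    holT (bgUnits F K (expHermField (F := F) (K := K)
      (fun b : PBond (F.P K) 0 =>
        (((s * (if (b.src b.dir).val % F.L = 0 then (1 : ℝ) else if (b.src b.dir).val % F.L = 1 then -1 else 0)) : ℝ) : ℂ) •
          spinHalfPauli b.dir))) (emb y₀) w :=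
  holT_emb_eq_of_blockPeriodic (bgUnits_field_translate_scale F K s) y y₀ w

/-! ## §2 The bonds of the commutator lattice are `s`-close to `1` -/

/-- ★ `‖U_s(b) − 1‖ ≤ s` (`L²`-operator norm; ✓p739060 `coe_expHerm_smul_pauli` + `norm_exp_I_smul_pauli_sub_one_le`, `|θ| ≤ 1`).
[cite: Balaban1985Averaging, (19) p.21; Balaban1985Variational, (112) p.294] -/
theorem norm_field_sub_one_le (s : ℝ) (hs : 0 ≤ s) (b : PBond (F.P K) 0) :
    ‖((expHermField (F := F) (K := K)
      (fun b : PBond (F.P K) 0 =>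
        (((s * (if (b.src b.dir).val % F.L = 0 then (1 : ℝ) else if (b.src b.dir).val % F.L = 1 then -1 else 0)) : ℝ) : ℂ) •
          spinHalfPauli b.dir) b : Matrix.specialUnitaryGroup (Fin 2) ℂ) : Matrix (Fin 2) (Fin 2) ℂ) - 1‖ ≤ s := by
  rw [expHermField_apply, coe_expHerm_smul_pauli]
  refine (norm_exp_I_smul_pauli_sub_one_le _ _).trans ?_
  have hθ : |(if (b.src b.dir).val % F.L = 0 then (1 : ℝ) else if (b.src b.dir).val % F.L = 1 then -1 else 0)| ≤ 1 := by
    split_ifs <;> simp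
  rw [abs_mul, abs_of_nonneg hs]
  nlinarith

/-! ## §3 SPEC-0 N4 `spec_lowMode`, token for token -/

variable (n : ℕ) (h : n ≤ K) (c₀ cB : ℝ) [Fact (0 < c₀)] [Fact (0 < cB)]

omit [Fact (0 < cB)] in
/-- ★★★ **SPEC-0 N4 (px12 g11 e654b2a4 :91–103) — THE DELOCALISED LOW MODE IN `N_S(U_s)` IS THE CONSTANT**: for every `c` (traceless or
not), `C₁ = 0`, `C₂ = 2`, `s₂ = min s₁ (40L)⁻¹` (`s₁` from N3c at `ρ = (10¹²L³)⁻¹`): `lam := fun _ => c` lies in `N_S(U_s)`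
(✓`Prop7HPcolNegConstantMode.lowMode_const` ⟸ §1 `hper`, N3b `htriv`, N3c `hreg`), is `c` on the nose, and has covariant gradient
`≤ 2s·L^{K−n}·‖c‖` bondwise (§2). [cite: Balaban1985BackgroundPropagators, (3.19) p.393, (3.3) p.391] -/
theorem spec_lowMode (hnK : n < K) (c : Matrix (Fin 2) (Fin 2) ℂ) (_hc : c.trace = 0) :
    ∃ C₁ C₂ s₂ : ℝ, 0 < s₂ ∧ ∀ s : ℝ, 0 < s → s ≤ s₂ →
      ∃ lam : Site (F.P K) 0 → Matrix (Fin 2) (Fin 2) ℂ,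
        toL2S F K c₀ lam ∈ NS F n K h c₀ cB (expHermField (F := F) (K := K)
      (fun b : PBond (F.P K) 0 =>
        (((s * (if (b.src b.dir).val % F.L = 0 then (1 : ℝ) else if (b.src b.dir).val % F.L = 1 then -1 else 0)) : ℝ) : ℂ) •
          spinHalfPauli b.dir)) ∧
        (∀ x, ‖lam x - c‖ ≤ C₁ * s * ‖c‖) ∧
        (∀ b, ‖((toL2 F K c₀).symm (DL2 F n K c₀ (expHermField (F := F) (K := K)
      (fun b : PBond (F.P K) 0 =>
        (((s * (if (b.src b.dir).val % F.L = 0 then (1 : ℝ) else if (b.src b.dir).val % F.L = 1 then -1 else 0)) : ℝ) : ℂ) •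
          spinHalfPauli b.dir)) (toL2S F K c₀ lam))) b‖ ≤ C₂ * s * (F.L : ℝ) ^ (K - n) * ‖c‖) := by
  have hL : (0 : ℝ) < F.L := by have := F.hL.2; exact_mod_cast (by omega : 0 < F.L)
  set ρ : ℝ := (10 ^ 12 * (F.L : ℝ) ^ 3)⁻¹ with hρ
  have hρ0 : 0 < ρ := by rw [hρ]; positivity
  have hWρ : 10 ^ 12 * (F.L : ℝ) ^ 3 * ρ ≤ 1 := by
    rw [hρ, mul_inv_cancel₀ (by positivity)]
  obtain ⟨s₁, hs₁, hreg⟩ := Prop7HPcolNegRegPr.spec_regPr_field F K n ρ hρ0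
  have h40 : (0 : ℝ) < 1 / (40 * (F.L : ℝ)) := by positivity
  refine ⟨0, 2, min s₁ (1 / (40 * (F.L : ℝ))), lt_min hs₁ h40, fun s hs hs₂ => ⟨fun _ => c, ?_⟩⟩
  have hreg' := hreg s hs (hs₂.trans (min_le_left _ _))
  have htriv := Prop7HPcolNegCommutatorLattice.spec_emlIterU_field_eq_one F K s hs.le (hs₂.trans (min_le_right _ _))
  obtain ⟨h1, h2, h3⟩ := lowMode_const (c₀ := c₀) F h cB hρ0 hWρ _ hreg' (fun _ => 0) (holT_emb_field_eq F K s · (fun _ => 0))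
    htriv hnK (norm_field_sub_one_le F K s hs.le) c
  exact ⟨h1, fun x => by simp, h3⟩

end Summit.QuantumFields.YangMills.Theorems.Prop7HPcolNegLowMode

end
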